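import Summits.BirchSwinnertonDyer.BirchSwinnertonDyer.Theorems.AlignedTransportAtTwoMainConjectureOfRankZeroBSDAtTwoFineRoadPerfectDescentSurj
import Literature.NumberTheory.GaloisRepresentations.KummerSignCharacter
import Literature.NumberTheory.EllipticCurves.TwoTorsionGaloisActionProofs
import Mathlib.Data.Real.Basic
import HarnessLib

/-!
# Preliminaries for the `Δ_E > 0` Kummer witness: the conjugation formula for the Kummer sign character, the products
# `αᵢ = (eᵢ − eᵢ₊₁)(eᵢ − eᵢ₊₂)` of `2`-division abscissae, and the sign pattern of three distinct reals

Cell `bsd-f1-sign2`, WIDTH-5 attach seat `bsd-line-att-p5` (gen 8) on line `birth` of crux C2 stmt-BirchSwinnertonDyer-22298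
`MainConjectureOfRankZeroBSDAtTwo` (route `AlignedTransportAtTwo`); toolkit for the sibling `…FineRoadRealKummerWitness` (the
`Δ > 0` witness `infKer (ker κ) E[2] w ≠ ⊤` asked for in the crux workfile `RELAXED-COEFFICIENTS-att-p5.md` §6). A
`--supports 22298 --as helper` file. HONEST FRAMING: THEOREMS ONLY — no definition, no named fact, no `sorry`; C2-NEUTRAL; BSD is NOT
proved by any of this.

* `ite_add_eq_add_ite` — the maps `ψ_T : ℤ/2 → M`, `0 ↦ 0`, `1 ↦ T` are additive when `T + T = 0`;
* `three_reals_sign` — for three DISTINCT reals the products `(rᵢ − rᵢ₊₁)(rᵢ − rᵢ₊₂)` are neither all positive (their product is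
  `−((r₀−r₁)(r₀−r₂)(r₁−r₂))²`) nor all non-positive (their sum is `½ Σ (rᵢ − rⱼ)²`) — exactly the middle one is negative;
* `smul_kummerSqrt_conj_iff`, **`kummerSign_conj_eq`** — the conjugation formula `χ_a(g x g⁻¹) = χ_{g⁻¹ a}(x)` for the tree's Kummer
  sign character (`Literature/…/KummerSignCharacter`): the `Γ_K`-equivariance of the Kummer map `F^×/F^{×2} → Hom(Gal(K̄/F), ℤ/2)`;
* `perm_succ_cases`, **`smul_alpha`** (`g αᵢ = α_{π_g i}` for `αᵢ := (eᵢ − eᵢ₊₁)(eᵢ − eᵢ₊₂)`, `eᵢ = x(Tᵢ)`, `π_g` the permutation of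
  the letters, tree `DokchitserDokchitser2012.smul_xT`), `alpha_ne_zero`, `permGal_eq_one_of_mem_ker`, `smul_alpha_of_mem_ker`
  (`ker ρ̄_{E,2}` fixes the `αᵢ`), `add_self_eq_zero_geomTorsion_two`, `T_add_T_ne_zero` (`Tᵢ ≠ 0` is the tree's
  `ThetaPartnerXRoute.T_ne_zero'`).

References: J.-P. Serre, *Local Fields* X §3 (Kummer theory); J. H. Silverman, *AEC* III.2.3, III.6.4(b), III.§7, VIII.§1;
T. Dokchitser, V. Dokchitser, Math. Z. 272 (2012), proof of the Theorem (the `2`-division abscissae).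
-/

set_option autoImplicit false
-- the Theorems namespace of this sub repeats the summit name by design (D-0017 nested layout)
set_option linter.dupNamespace false

noncomputable section

open scoped Classical

namespace Summit.BirchSwinnertonDyer.BirchSwinnertonDyer.Theorems.AlignedTransportAtTwoFineRoad.RealKummerWitnessPrelim

open WeierstrassCurve Field Literature.NumberTheory.EllipticCurves Literature.NumberTheory.GaloisRepresentations
  Literature.NumberTheory.EllipticCurves.DokchitserDokchitser2012
  Summit.BirchSwinnertonDyer.BirchSwinnertonDyer.Theorems.AlignedTransportAtTwoFineRoad

universe u

/-! ## §1 Algebra: `ℤ/2`-valued switches, three reals, the Kummer sign character under conjugation -/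

section Prelim

/-- The maps `ψ_T : ℤ/2 → M`, `0 ↦ 0`, `1 ↦ T` are additive when `T + T = 0`. [folklore] -/
theorem ite_add_eq_add_ite {M : Type*} [AddCommGroup M] (T : M) (hT : T + T = 0) (u v : ZMod 2) :
    (if u + v = 0 then (0 : M) else T) = (if u = 0 then 0 else T) + (if v = 0 then 0 else T) := by
  have huv : ∀ c : ZMod 2, c = 0 ∨ c = 1 := by decide
  have h1 : (1 : ZMod 2) ≠ 0 := by decide
  have h11 : (1 : ZMod 2) + 1 = 0 := by decide
  rcases huv u with rfl | rfl <;> rcases huv v with rfl | rfl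
  · rw [add_zero, if_pos rfl, add_zero]
  · rw [zero_add, if_neg h1, if_pos rfl, zero_add]
  · rw [add_zero, if_neg h1, if_pos rfl, add_zero]
  · rw [h11, if_pos rfl, if_neg h1, hT]

/-- **Three distinct reals: the products `(rᵢ − rᵢ₊₁)(rᵢ − rᵢ₊₂)` are neither all positive nor all non-positive** (their product
is `−((r₀−r₁)(r₀−r₂)(r₁−r₂))² < 0`, their sum is `½ Σ (rᵢ−rⱼ)² > 0`; in fact exactly the middle one is negative). [folklore] -/
theorem three_reals_sign (r₀ r₁ r₂ : ℝ) (h01 : r₀ ≠ r₁) (h02 : r₀ ≠ r₂) (h12 : r₁ ≠ r₂) :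
    ¬ (0 < (r₀ - r₁) * (r₀ - r₂) ∧ 0 < (r₁ - r₂) * (r₁ - r₀) ∧ 0 < (r₂ - r₀) * (r₂ - r₁)) ∧
      ¬ ((r₀ - r₁) * (r₀ - r₂) ≤ 0 ∧ (r₁ - r₂) * (r₁ - r₀) ≤ 0 ∧ (r₂ - r₀) * (r₂ - r₁) ≤ 0) := by
  constructor
  · rintro ⟨h0, h1, h2⟩
    have hd : (r₀ - r₁) * (r₀ - r₂) * (r₁ - r₂) ≠ 0 :=
      mul_ne_zero (mul_ne_zero (sub_ne_zero.2 h01) (sub_ne_zero.2 h02)) (sub_ne_zero.2 h12)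
    have hsq : 0 < ((r₀ - r₁) * (r₀ - r₂) * (r₁ - r₂)) * ((r₀ - r₁) * (r₀ - r₂) * (r₁ - r₂)) := mul_self_pos.2 hd
    have hprod : 0 < ((r₀ - r₁) * (r₀ - r₂)) * ((r₁ - r₂) * (r₁ - r₀)) * ((r₂ - r₀) * (r₂ - r₁)) :=
      mul_pos (mul_pos h0 h1) h2
    have hid : ((r₀ - r₁) * (r₀ - r₂)) * ((r₁ - r₂) * (r₁ - r₀)) * ((r₂ - r₀) * (r₂ - r₁)) =
        -(((r₀ - r₁) * (r₀ - r₂) * (r₁ - r₂)) * ((r₀ - r₁) * (r₀ - r₂) * (r₁ - r₂))) := by ring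
    linarith
  · rintro ⟨h0, h1, h2⟩
    have hid : (r₀ - r₁) * (r₀ - r₂) + (r₁ - r₂) * (r₁ - r₀) + (r₂ - r₀) * (r₂ - r₁) =
        ((r₀ - r₁) * (r₀ - r₁) + (r₀ - r₂) * (r₀ - r₂) + (r₁ - r₂) * (r₁ - r₂)) / 2 := by ring
    have hsq : 0 < (r₀ - r₁) * (r₀ - r₁) := mul_self_pos.2 (sub_ne_zero.2 h01)
    nlinarith [mul_self_nonneg (r₀ - r₂), mul_self_nonneg (r₁ - r₂)]

variable {K : Type u} [Field K]

/-- The square roots under conjugation: if `g⁻¹ a = b` and `x` fixes `b`, then `g x g⁻¹` fixes `√a` iff `x` fixes `√b` (`g⁻¹ √a` is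
`± √b`). [cite: SerreLocalFields1979, X §3] -/
theorem smul_kummerSqrt_conj_iff {a b : AlgebraicClosure K} (g x : absoluteGaloisGroup K) (hgab : g⁻¹ • a = b) :
    (g * x * g⁻¹) • kummerSqrt a = kummerSqrt a ↔ x • kummerSqrt b = kummerSqrt b := by
  have hsq : (g⁻¹ • kummerSqrt a) * (g⁻¹ • kummerSqrt a) = kummerSqrt b * kummerSqrt b := by
    rw [← smul_mul', kummerSqrt_mul_self, hgab, kummerSqrt_mul_self]
  have hstep : ∀ y : AlgebraicClosure K, (g * x * g⁻¹) • y = g • (x • (g⁻¹ • y)) := fun y ↦ by rw [mul_smul, mul_smul]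
  have hginj : ∀ z : AlgebraicClosure K, g • z = kummerSqrt a ↔ z = g⁻¹ • kummerSqrt a := fun z ↦
    ⟨fun h ↦ by rw [← h, inv_smul_smul], fun h ↦ by rw [h, smul_inv_smul]⟩
  rw [hstep, hginj]
  rcases mul_self_eq_mul_self_iff.mp hsq with h | h
  · rw [h]
  · rw [h, smul_neg, neg_inj]

/-- **Conjugation formula for the Kummer sign character: `χ_a(g x g⁻¹) = χ_{g⁻¹ a}(x)`** (`x, g x g⁻¹ ∈ N`, `N` fixing `a` and
`b = g⁻¹ a`). This is the `Γ_K`-equivariance of the Kummer map `F^×/F^{×2} → Hom(Gal(K̄/F), ℤ/2)`. [cite: SerreLocalFields1979, X §3] -/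
theorem kummerSign_conj_eq [CharZero K] {a b : AlgebraicClosure K} (ha : a ≠ 0) (hb : b ≠ 0) (N : Subgroup (absoluteGaloisGroup K))
    (hNa : ∀ n ∈ N, n • a = a) (hNb : ∀ n ∈ N, n • b = b) (g : absoluteGaloisGroup K) (hgab : g⁻¹ • a = b) (x y : N)
    (hy : (y : absoluteGaloisGroup K) = g * x * g⁻¹) :
    kummerSign a ha N hNa y = kummerSign b hb N hNb x := by
  have hab : ∀ c : Multiplicative (ZMod 2), c = 1 ∨ c = Multiplicative.ofAdd 1 := by decide
  have h1 : Multiplicative.ofAdd (1 : ZMod 2) ≠ 1 := by decide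
  have hiff : kummerSign a ha N hNa y = 1 ↔ kummerSign b hb N hNb x = 1 := by
    rw [kummerSign_eq_one_iff, kummerSign_eq_one_iff, hy]
    exact smul_kummerSqrt_conj_iff g x hgab
  rcases hab (kummerSign a ha N hNa y) with h | h <;> rcases hab (kummerSign b hb N hNb x) with h' | h'
  · rw [h, h']
  · exact absurd (hiff.mp h) (by rw [h']; exact h1)
  · exact absurd (hiff.mpr h') (by rw [h]; exact h1)
  · rw [h, h']

/-- The permutations of three letters indexed cyclically: `{π(i+1), π(i+2)} = {π(i)+1, π(i)+2}`. [folklore] -/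
theorem perm_succ_cases : ∀ (π : Equiv.Perm (Fin 3)) (i : Fin 3),
    (π (i + 1) = π i + 1 ∧ π (i + 2) = π i + 2) ∨ (π (i + 1) = π i + 2 ∧ π (i + 2) = π i + 1) := by
  decide

end Prelim

/-! ## §2 The products `αᵢ` of `2`-division abscissae and the letters `Tᵢ` -/

section CurvePrelim

variable {K : Type} [Field K] (W : WeierstrassCurve K) [W.IsElliptic] (h2 : (2 : K) ≠ 0)

/-- **`g αᵢ = α_{π_g i}`** for `αᵢ := (eᵢ − eᵢ₊₁)(eᵢ − eᵢ₊₂)`, `eᵢ = x(Tᵢ)` the `2`-division abscissae, `π_g` the permutation of the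
letters induced by `g ∈ Γ_K` (`smul_xT`). [cite: SilvermanAEC2009, VIII.§1 (G_{K̄/K} acts on E(K̄) coordinatewise)] -/
theorem smul_alpha (g : absoluteGaloisGroup K) (i : Fin 3) :
    g • ((xT W h2 i - xT W h2 (i + 1)) * (xT W h2 i - xT W h2 (i + 2))) =
      (xT W h2 (permGal W h2 g i) - xT W h2 (permGal W h2 g i + 1)) *
        (xT W h2 (permGal W h2 g i) - xT W h2 (permGal W h2 g i + 2)) := by
  rw [smul_mul', smul_sub, smul_sub, smul_xT, smul_xT, smul_xT]
  rcases perm_succ_cases (permGal W h2 g) i with ⟨h1, h2'⟩ | ⟨h1, h2'⟩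
  · rw [h1, h2']
  · rw [h1, h2', mul_comm]

/-- `αᵢ ≠ 0` (the abscissae `eᵢ` are distinct). [cite: SilvermanAEC2009, III.2.3 (points with equal abscissa are P or −P)] -/
theorem alpha_ne_zero (i : Fin 3) : (xT W h2 i - xT W h2 (i + 1)) * (xT W h2 i - xT W h2 (i + 2)) ≠ 0 := by
  have hs1 : ∀ j : Fin 3, j ≠ j + 1 := by decide
  have hs2 : ∀ j : Fin 3, j ≠ j + 2 := by decide
  exact mul_ne_zero (sub_ne_zero.2 ((xT_injective W h2).ne (hs1 i))) (sub_ne_zero.2 ((xT_injective W h2).ne (hs2 i)))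

/-- An element of `ker ρ̄_{E,2}` induces the identity permutation of the letters. [cite: SilvermanAEC2009, III.§7] -/
theorem permGal_eq_one_of_mem_ker {n : absoluteGaloisGroup K} (hn : n ∈ (W.galoisRepTorsion 2).ker) :
    permGal W h2 n = 1 := by
  refine Equiv.ext fun i ↦ T_injective W h2 ?_
  rw [T_permGal, Equiv.Perm.one_apply]
  exact PerfectDescent.smul_eq_self_of_mem_ker_galoisRepTorsion_two W hn (T W h2 i)

/-- `ker ρ̄_{E,2}` fixes the `αᵢ`. [cite: SilvermanAEC2009, III.§7] -/
theorem smul_alpha_of_mem_ker {n : absoluteGaloisGroup K} (hn : n ∈ (W.galoisRepTorsion 2).ker) (i : Fin 3) :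
    n • ((xT W h2 i - xT W h2 (i + 1)) * (xT W h2 i - xT W h2 (i + 2))) =
      (xT W h2 i - xT W h2 (i + 1)) * (xT W h2 i - xT W h2 (i + 2)) := by
  rw [smul_alpha, permGal_eq_one_of_mem_ker W h2 hn, Equiv.Perm.one_apply]

omit [W.IsElliptic] in
/-- Every point of `E[2]` is killed by `2`. [cite: SilvermanAEC2009, Cor. III.6.4(b) (E[m] ≅ ℤ/mℤ × ℤ/mℤ)] -/
theorem add_self_eq_zero_geomTorsion_two (m : ↥(W.geomTorsion 2)) : m + m = 0 :=
  Subtype.ext (by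
    have h : (m : W.geomPoints) ∈ W.geomTorsion 2 := m.2
    rw [WeierstrassCurve.mem_geomTorsion_iff, two_zsmul] at h
    exact h)

/-- `Tᵢ + Tⱼ ≠ 0` for `i ≠ j` (it is the third letter). [cite: SilvermanAEC2009, Cor. III.6.4(b) (E[m] ≅ ℤ/mℤ × ℤ/mℤ)] -/
theorem T_add_T_ne_zero {i j : Fin 3} (hij : i ≠ j) : T W h2 i + T W h2 j ≠ 0 := by
  intro h
  apply hij
  apply T_injective W h2
  have h1 : T W h2 i = -T W h2 j := eq_neg_of_add_eq_zero_left h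
  have h2' : -T W h2 j = T W h2 j := by
    rw [neg_eq_iff_add_eq_zero, add_self_eq_zero_geomTorsion_two]
  rw [h1, h2']

end CurvePrelim

end Summit.BirchSwinnertonDyer.BirchSwinnertonDyer.Theorems.AlignedTransportAtTwoFineRoad.RealKummerWitnessPrelim

end
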